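import Summits.CriticalPhenomena.CardyFormulaZ2.Theorems.ParafermionPrecompact.Negative.HeadPassage
import Literature.Probability.LatticeModels.ObservableAprioriBound

/-!
# `ParafermionPrecompact` (stmt-CriticalPhenomena-11293): at most two passages per medial vertex,
# the free exponent `0`, and exponent bookkeeping for the repaired clauses

Refuter `refuter-cdisprove-stmt-CriticalPhenomena-11293-g2-0` (cdisprove, cycle 2), companion to
`HeadPassage.lean` (same namespace and vocabulary).

* **At most two passages; the trivial a-priori bound.**  Along the admissible exploration every
  medial vertex is passed at most twice (the tree's `card_filter_cSrc_cornerOrbit_le_two` of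
  `ObservableAprioriBound.lean`, written for the FK-Ising copy of the observable; here transported
  to the `MedialPath` copy of `passageSum` used by the percolation routes), so
  `‖passageSum‖ ≤ 2` (`norm_passageSum_medialExploration_le_two`) and `‖F Λ δ z‖ ≤ 2`
  (`norm_F_le_two`): the repaired bound clause at exponent `0` is FREE for every eventually
  admissible family (`eventually_norm_F_le_two`).
* **Exponent bookkeeping** (`clauses_of_bound_lt`, `repairedClauses_of_bound_gt_third`): a bound at
  ANY exponent `t > s` gives BOTH repaired clauses (bound and equicontinuity) at `s`, on any `K`.
  Together with `HeadPassage.not_clauseBoundExp_closure` (every exponent `s > 0` fails at the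
  boundary) this
  locates the content of `C′ = ParafermionPrecompactRepairedAt` exactly: push the free bulk
  exponent `0` (rigorously: an RSW arm exponent) up to `1/3` on compacts of `Ω`; at `s = 1/3`
  itself the equicontinuity clause (ii) is the whole difficulty (tightness of the DCS 2012
  Conjecture 8.7 normalisation at `σ = 1/3`).
-/

noncomputable section

namespace Summit.CriticalPhenomena.CardyFormulaZ2.Theorems.ParafermionPrecompact.Negative

open _root_.Literature.Probability.LatticeModels _root_.Literature.Probability.RandomPlanarGeometry
open _root_.Literature.Probability.Percolation _root_.MeasureTheory _root_.Filter _root_.Set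
open _root_.Literature.Probability.LatticeModels.DiscreteDobrushin (startCorner exitTime
  isStartCorner_startCorner medialExploration_eq_explorationList isInnerFace_of_lt_exitTime)
open scoped _root_.Topology

/-! ## §4 At most two passages through a medial vertex; the free exponent `0`; exponent bookkeeping -/

section TwoPassages

variable {Dd : DiscreteDobrushin}

/-- `‖passageSum (medialExploration D ω) δ σ z‖ ≤ 2` for admissible data (at most two unimodular
terms). [folklore] -/
theorem norm_passageSum_medialExploration_le_two (hD : Dd.IsZdAdmissible) (ω : BondConfig (Site 2))
    (δ σ : ℝ) (z : MedialVertex) : ‖MedialPath.passageSum (medialExploration Dd ω) δ σ z‖ ≤ 2 := by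
  rw [medialExploration_eq_explorationList hD ω, medialPath_passageSum_explorationList]
  refine (norm_sum_le _ _).trans ?_
  simp only [norm_exp_neg_I_mul, Finset.sum_const, nsmul_eq_mul, mul_one]
  exact_mod_cast card_filter_cSrc_cornerOrbit_le_two hD (isStartCorner_startCorner hD)
    (fun i hi => isInnerFace_of_lt_exitTime hD ω hi) z

/-- Without admissibility the junk branch is `0`; so `‖passageSum (medialExploration D ω)‖ ≤ 2`
whenever the data are admissible OR the path is junk — in particular eventually along a family.
[folklore] -/
theorem norm_F_le_two (Λ : ℝ → DiscreteDobrushin) {δ : ℝ} (hD : (Λ δ).IsZdAdmissible)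
    (z : MedialVertex) : ‖F Λ δ z‖ ≤ 2 := by
  unfold F
  refine (norm_integral_le_of_norm_le_const (C := 2) ?_).trans (by simp)
  exact Filter.Eventually.of_forall fun ω => norm_passageSum_medialExploration_le_two hD ω δ _ z

/-- **Exponent `0` is free**: eventually along every admissible family, `‖F Λ δ z‖ ≤ 2` for all
medial vertices `z` (so the repaired bound clause with `δ^0` in place of `δ^{1/3}` holds with
`C = 2` on any `K`). [folklore] -/
theorem eventually_norm_F_le_two {D : DobrushinDomain} {Λ : ℝ → DiscreteDobrushin}
    (hΛ : IsFamily D Λ) : ∀ᶠ δ in 𝓝[>] (0:ℝ), ∀ z : MedialVertex, ‖F Λ δ z‖ ≤ 2 := by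
  filter_upwards [hΛ.2.2.2.2.2] with δ hD z
  exact norm_F_le_two Λ hD z

/-- **Exponent bookkeeping.**  A bound at ANY exponent `t > s` gives BOTH repaired clauses at
`s` (on any `K`): `‖F‖ ≤ C δ^t = (C δ^{t-s}) δ^s` with `C δ^{t-s} → 0`.  So the set of exponents
at which `C′` holds is decided by the bound clause alone strictly below its supremum; at the
conjectured endpoint `s = 1/3` the equicontinuity clause is the entire content. [folklore] -/
theorem clauses_of_bound_lt {Λ : ℝ → DiscreteDobrushin} {K : Set ℂ} {s t : ℝ} (hst : s < t)
    (h : ∃ C : ℝ, ∀ᶠ δ in 𝓝[>] (0:ℝ), ∀ z : MedialVertex, z ∈ (zdGraph 2).edgeSet →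
      medialPoint δ z ∈ K → ‖F Λ δ z‖ ≤ C * δ ^ t) :
    (∃ C : ℝ, ∀ᶠ δ in 𝓝[>] (0:ℝ), ∀ z : MedialVertex, z ∈ (zdGraph 2).edgeSet →
      medialPoint δ z ∈ K → ‖F Λ δ z‖ ≤ C * δ ^ s) ∧
    (∀ ε > (0:ℝ), ∃ η > (0:ℝ), ∀ᶠ δ in 𝓝[>] (0:ℝ), ∀ z z' : MedialVertex,
      z ∈ (zdGraph 2).edgeSet → z' ∈ (zdGraph 2).edgeSet →
      medialPoint δ z ∈ K → medialPoint δ z' ∈ K → dist (medialPoint δ z) (medialPoint δ z') < η →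
        ‖F Λ δ z - F Λ δ z'‖ ≤ ε * δ ^ s) := by
  obtain ⟨C, hC⟩ := h
  have hsplit : ∀ δ : ℝ, 0 < δ → δ ^ t = δ ^ (t - s) * δ ^ s := fun δ hδ => by
    rw [← Real.rpow_add hδ]; ring_nf
  have key : ∀ ε > (0:ℝ), ∀ᶠ δ in 𝓝[>] (0:ℝ), ∀ z : MedialVertex, z ∈ (zdGraph 2).edgeSet →
      medialPoint δ z ∈ K → ‖F Λ δ z‖ ≤ ε * δ ^ s := by
    intro ε hε
    have hsmall := eventually_const_mul_rpow_lt_one (|C| / ε) (sub_pos.2 hst)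
    filter_upwards [hC, hsmall, self_mem_nhdsWithin] with δ hδ hlt (hpos : 0 < δ) z hz hzK
    have hds : 0 < δ ^ s := Real.rpow_pos_of_pos hpos s
    have h1 := hδ z hz hzK
    rw [hsplit δ hpos] at h1
    have h2 : C * (δ ^ (t - s) * δ ^ s) ≤ |C| * δ ^ (t - s) * δ ^ s := by
      rw [← mul_assoc]
      exact mul_le_mul_of_nonneg_right (mul_le_mul_of_nonneg_right (le_abs_self C)
        (Real.rpow_nonneg hpos.le _)) hds.le
    have h3 : |C| * δ ^ (t - s) < ε := by
      have h' := mul_lt_mul_of_pos_right hlt hε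
      rw [one_mul] at h'
      calc |C| * δ ^ (t - s) = |C| / ε * δ ^ (t - s) * ε := by
            rw [div_mul_eq_mul_div, div_mul_cancel₀ _ hε.ne']
        _ < ε := h'
    calc ‖F Λ δ z‖ ≤ |C| * δ ^ (t - s) * δ ^ s := h1.trans h2
      _ ≤ ε * δ ^ s := mul_le_mul_of_nonneg_right h3.le hds.le
  refine ⟨⟨1, by simpa using key 1 one_pos⟩, fun ε hε => ⟨1, one_pos, ?_⟩⟩
  filter_upwards [key (ε / 2) (half_pos hε)] with δ hδ z z' hz hz' hzK hz'K _
  calc ‖F Λ δ z - F Λ δ z'‖ ≤ ‖F Λ δ z‖ + ‖F Λ δ z'‖ := norm_sub_le _ _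
    _ ≤ ε / 2 * δ ^ s + ε / 2 * δ ^ s := add_le_add (hδ z hz hzK) (hδ z' hz' hz'K)
    _ = ε * δ ^ s := by ring

/-- In the vocabulary of `C′`: a bound at any exponent `t > 1/3` on `K` gives BOTH repaired clauses
of `ParafermionPrecompactRepairedAt` on `K` — so at the conjectured sharp exponent `1/3` the
equicontinuity clause (ii) is exactly the part of `C′` not implied by any bound clause. [folklore] -/
theorem repairedClauses_of_bound_gt_third {Λ : ℝ → DiscreteDobrushin} {K : Set ℂ} {t : ℝ}
    (ht : (1:ℝ) / 3 < t)
    (h : ∃ C : ℝ, ∀ᶠ δ in 𝓝[>] (0:ℝ), ∀ z : MedialVertex, z ∈ (zdGraph 2).edgeSet →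
      medialPoint δ z ∈ K → ‖F Λ δ z‖ ≤ C * δ ^ t) :
    ClauseBoundEdges Λ K ∧ ClauseEquicontEdges Λ K :=
  clauses_of_bound_lt ht h

end TwoPassages

end Summit.CriticalPhenomena.CardyFormulaZ2.Theorems.ParafermionPrecompact.Negative

end
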